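import Summits.Ventures.PackingBounds.ThreePointCert.K10d14AggG1
import Summits.Ventures.PackingBounds.ThreePointCert.K10d14AggG2
import Summits.Ventures.PackingBounds.ThreePointCert.K10d14AggG3
import Summits.Ventures.PackingBounds.ThreePointCert.K10d14AggP
import Summits.Ventures.PackingBounds.ThreePointCert.CheckKSP

/-!
# κ(10) ≤ 554: kernel validation (Kronecker substitution) of Gram blocks/parts R0.stdB.g2, R0.stdB.g3, R1.sym.g1 (25338 factor entries; part 3 of 9)

Framing: lottery ticket; floor = certified bounds/negative ranges. Venture `PackingBounds` (cell
`pub-packcert`), three-point SDP family, kissing column. Integer data / kernel checks of a feasible point of the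
Bachoc–Vallentin semidefinite program (n = 10, s = 1/2, three-point matrix degree 14, two-point (Gegenbauer) part to
degree L = 28, Bachoc–Vallentin multiplier set = cell mode sym2; exact rational certificate `sdp-n10-d14-s1-2-sym2-a28-hyb8dd-j155388.json`
(sha256 f94b593f4d1d897547c6aff3d155bbc0464b297841bce8165d2c2b302274bf2e) of the sdp seat's hybrid pipeline, verified by the cell's two exact verifiers), converted by
`cert2lean_g9.py` (lp gen 9; S = 66) into the units of the kernel checker `ThreePointCert.Check` + `CheckSym2` with the
record degree field set to L = 28 (the checker's degree enters only the unit `W = 2^d·d!` and the side conditions, so a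
(d, L) certificate is a `Cert3` of degree L); symmetry-adapted PARTS (S₃/S₂ isotypic bases of short polynomials) with coarse factor COLUMNS, validated by
Kronecker substitution `ThreePointCert.CheckKSP` (`sosCheckKSParts`: the claimed expansion and `Σ_parts Σ_k col_k²` compared at `(2^w, 2^{wD}, 2^{wD²})`); three-point part by `CheckFKS`;
split check of (ii') `ThreePointCert.CheckSym2Split`. Emitter `emitlean_ks3.py` (lp gen 10; expansions `4^k • Σ_parts pᵀ(L′L′ᵀ)p` lifted by `SoundNN.boxNonneg_smul`). Generated file: plain lists of integers / monomials.
-/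

namespace Summit.Ventures.PackingBounds.ThreePointCert.K10d14

open Literature.Geometry.DiscreteGeometry Literature.Geometry.DiscreteGeometry.PolyCert PolyCert.SPoly

set_option maxRecDepth 100000 in
set_option maxHeartbeats 0 in
/-- Block `R0`, part `stdB`, column group 2 (columns 61–169, 11990 factor entries): its expansion IS `Σ_(k in group) col_k²` — Kronecker-substitution check at `(2^204, 2^(204·29), …)`. -/
theorem vR0pstdBg2 : sosCheckKSParts 204 29 1 [K10d14.partR0stdBg2] K10d14.eR0pstdBg2 = true := by
  decide +kernel

set_option maxRecDepth 100000 in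
set_option maxHeartbeats 0 in
/-- Block `R0`, part `stdB`, column group 3 (columns 170–224, 1540 factor entries): its expansion IS `Σ_(k in group) col_k²` — Kronecker-substitution check at `(2^199, 2^(199·29), …)`. -/
theorem vR0pstdBg3 : sosCheckKSParts 199 29 1 [K10d14.partR0stdBg3] K10d14.eR0pstdBg3 = true := by
  decide +kernel

set_option maxRecDepth 100000 in
set_option maxHeartbeats 0 in
/-- Block `R1`, part `sym`, column group 1 (columns 0–40, 11808 factor entries): its expansion IS `Σ_(k in group) col_k²` — Kronecker-substitution check at `(2^200, 2^(200·27), …)`. -/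
theorem vR1psymg1 : sosCheckKSParts 200 27 1 [K10d14.partR1symg1] K10d14.eR1psymg1 = true := by
  decide +kernel

end Summit.Ventures.PackingBounds.ThreePointCert.K10d14
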